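import Mathlib
import Summits.ValiantsHypothesis.ValiantsHypothesis.Theorems.LacunarySymmetroidMatrixDescartesCensusWindowFourPocketRows
import Summits.ValiantsHypothesis.ValiantsHypothesis.Theorems.LacunarySymmetroidMatrixDescartesCensusWindowFourPocketCalculus

/-!
# `MatrixDescartes` census — WINDOW-4 POCKET ROWS V: LOG-LINEAR and NUMERAL-FRIENDLY forms (the currency of the hull-edge LP)

HONEST FRAMING.  Object-search cell `pub-symmetroid`, door-A target `DoorA26 := PosRootLawAt 2 6 19`
(stmt-ValiantsHypothesis-19979; OPEN, typed, never asserted).  Necessary-condition rows about the four-term WINDOWS of HYPOTHETICAL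
Descartes-sharp fewnomials; nothing here bounds any census count, kills any cell or bears on `MatrixDescartes`
(stmt-ValiantsHypothesis-18050) / `VP ≠ VNP`.

The four monotone pocket rows of `…CensusWindowFourPocketRows` restated in the LOG-LINEAR currency an LP certificate uses: with
`σ1 := (u+v)·log b − v·log a − u·log c` (`= log Σ1`), `σ2 := (v+w)·log c − w·log b − v·log e` (`= log Σ2`) and, for a branch parameter
`t > 0`, `L1(t) := (u+v)·log((u+v)+wt) − u·log(u+(v+w)t) − v·log v` (`= log H1(t)`),
`L2(t) := (v+w)·log(u+(v+w)t) − w·log((u+v)+wt) − v·log t − v·log v` (`= log H2(t)`):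

* `fourNomial_pocket_lower_log` (`t` lower: `L2(t) ≤ σ2 ⇒ L1(t) ≤ σ1`), `fourNomial_pocket_lower_log'` (`σ1 ≤ L1(t) ⇒ σ2 ≤ L2(t)`),
  `fourNomial_pocket_upper_log` (`t` upper: `L1(t) ≤ σ1 ⇒ L2(t) ≤ σ2`), `fourNomial_pocket_upper_log'` (`σ2 ≤ L2(t) ⇒ σ1 ≤ L1(t)`);
* NUMERAL-FRIENDLY forms `…_log_of_le`, `…_log_of_le'` (both branches): the kill file supplies the branch fact (`log M ≤ σ2`, …) with a
  SMOOTH rational `M` (its certified log table bounds `log M`), and CLOSED rational inequalities (`norm_num`) `H2(t) ≤ M`, `F ≤ H1(t)`,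
  … relating `M`, the emitted constant `F` and the parameter `t = tn/td`; conclusion `log F ≤ σ1` (resp. `σ2 ≤ log G`, …).  Choosing `t`
  rational directly (instead of a rational double root `ρ` of the normal form, `t = ρ^S`) keeps the numerals small.

With `…CensusWindowFourSharpBridge` these apply verbatim to a window of a sharp fewnomial (`a, b, c, e := |c_t|·M_t`).  The secant
(«xt-sec») rows are in `…CensusWindowFourPocketSecant`.

[folklore] `Real.log` is monotone; elementary.
-/

-- `Summit.ValiantsHypothesis.ValiantsHypothesis.…` repeats a component by the D-0017 layout
-- (single-conjunct summit), which the `dupNamespace` linter flags; the name is mandated.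
set_option linter.dupNamespace false

namespace Summit.ValiantsHypothesis.ValiantsHypothesis.Theorems.LacunarySymmetroidMatrixDescartes.Census

open Polynomial Finset Set
open scoped BigOperators Polynomial

/-! ## LOG form of the four monotone pocket rows (`σ1 = log Σ1`, `σ2 = log Σ2`, `L1 = log H1`, `L2 = log H2`) -/

/-- **Pocket row A (lower branch), log form**: `w(v+w)t ≤ u(u+v)`, `L2(t) ≤ σ2 ⇒ L1(t) ≤ σ1`. [folklore] -/
theorem fourNomial_pocket_lower_log {u v w : ℕ} (hu : 0 < u) (hv : 0 < v) (hw : 0 < w)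
    {a b c e : ℝ} (ha : 0 < a) (hb : 0 < b) (hc : 0 < c) (he : 0 < e)
    (h3 : 3 ≤ (C a - C b * X ^ u + C c * X ^ (u + v) - C e * X ^ (u + v + w) : ℝ[X]).roots.countP (fun x => 0 < x))
    {t : ℝ} (ht : 0 < t) (hlow : (w : ℝ) * ((v : ℝ) + w) * t ≤ (u : ℝ) * ((u : ℝ) + v))
    (hM : (((v : ℝ) + w) * Real.log ((u : ℝ) + ((v : ℝ) + w) * t) - (w : ℝ) * Real.log (((u : ℝ) + v) + (w : ℝ) * t) - (v : ℝ) * Real.log t) - (v : ℝ) * Real.log (v : ℝ)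
      ≤ (((v : ℝ) + w) * Real.log c - (w : ℝ) * Real.log b - (v : ℝ) * Real.log e)) :
    (((u : ℝ) + v) * Real.log (((u : ℝ) + v) + (w : ℝ) * t) - (u : ℝ) * Real.log ((u : ℝ) + ((v : ℝ) + w) * t)) - (v : ℝ) * Real.log (v : ℝ)
      ≤ (((u : ℝ) + v) * Real.log b - (v : ℝ) * Real.log a - (u : ℝ) * Real.log c) := by
  have hv0 : (0 : ℝ) < v := by exact_mod_cast hv
  have hA : 0 < (((u : ℝ) + v) + (w : ℝ) * t) := by positivity
  have hB : 0 < ((u : ℝ) + ((v : ℝ) + w) * t) := by positivity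
  have e1 : Real.log (a ^ v * c ^ u * (((u : ℝ) + v) + (w : ℝ) * t) ^ (u + v))
      = (v : ℝ) * Real.log a + (u : ℝ) * Real.log c + ((u + v : ℕ) : ℝ) * Real.log (((u : ℝ) + v) + (w : ℝ) * t) :=
    log_pow_mul_pow_mul_pow ha hc hA _ _ _
  have e2 : Real.log (b ^ (u + v) * (v : ℝ) ^ v * ((u : ℝ) + ((v : ℝ) + w) * t) ^ u)
      = ((u + v : ℕ) : ℝ) * Real.log b + (v : ℝ) * Real.log (v : ℝ) + (u : ℝ) * Real.log ((u : ℝ) + ((v : ℝ) + w) * t) :=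
    log_pow_mul_pow_mul_pow hb hv0 hB _ _ _
  have e3 : Real.log (b ^ w * e ^ v * ((u : ℝ) + ((v : ℝ) + w) * t) ^ (v + w))
      = (w : ℝ) * Real.log b + (v : ℝ) * Real.log e + ((v + w : ℕ) : ℝ) * Real.log ((u : ℝ) + ((v : ℝ) + w) * t) :=
    log_pow_mul_pow_mul_pow hb he hB _ _ _
  have e4 : Real.log (c ^ (v + w) * (v : ℝ) ^ v * ((((u : ℝ) + v) + (w : ℝ) * t) ^ w * t ^ v))
      = ((v + w : ℕ) : ℝ) * Real.log c + (v : ℝ) * Real.log (v : ℝ)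
        + ((w : ℝ) * Real.log (((u : ℝ) + v) + (w : ℝ) * t) + (v : ℝ) * Real.log t) := by
    rw [Real.log_mul (by positivity) (by positivity), Real.log_mul (by positivity) (by positivity),
      Real.log_mul (by positivity) (by positivity), Real.log_pow, Real.log_pow, Real.log_pow, Real.log_pow]
  push_cast at e1 e2 e3 e4
  have hMp : b ^ w * e ^ v * ((u : ℝ) + ((v : ℝ) + w) * t) ^ (v + w)
      ≤ c ^ (v + w) * (v : ℝ) ^ v * ((((u : ℝ) + v) + (w : ℝ) * t) ^ w * t ^ v) := by
    refine (Real.log_le_log_iff (by positivity) (by positivity)).mp ?_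
    rw [e3, e4]; linarith
  have hr := fourNomial_pocket_lower_of_three_le_countP hu hv hw ha hb hc he h3 ht hlow hMp
  have hl := (Real.log_le_log_iff (by positivity) (by positivity)).mpr hr
  rw [e1, e2] at hl
  linarith

/-- **Pocket row B (lower branch), log form**: `w(v+w)t ≤ u(u+v)`, `σ1 ≤ L1(t) ⇒ σ2 ≤ L2(t)`. [folklore] -/
theorem fourNomial_pocket_lower_log' {u v w : ℕ} (hu : 0 < u) (hv : 0 < v) (hw : 0 < w)
    {a b c e : ℝ} (ha : 0 < a) (hb : 0 < b) (hc : 0 < c) (he : 0 < e)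
    (h3 : 3 ≤ (C a - C b * X ^ u + C c * X ^ (u + v) - C e * X ^ (u + v + w) : ℝ[X]).roots.countP (fun x => 0 < x))
    {t : ℝ} (ht : 0 < t) (hlow : (w : ℝ) * ((v : ℝ) + w) * t ≤ (u : ℝ) * ((u : ℝ) + v))
    (hH : (((u : ℝ) + v) * Real.log b - (v : ℝ) * Real.log a - (u : ℝ) * Real.log c)
      ≤ (((u : ℝ) + v) * Real.log (((u : ℝ) + v) + (w : ℝ) * t) - (u : ℝ) * Real.log ((u : ℝ) + ((v : ℝ) + w) * t)) - (v : ℝ) * Real.log (v : ℝ)) :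
    (((v : ℝ) + w) * Real.log c - (w : ℝ) * Real.log b - (v : ℝ) * Real.log e)
      ≤ (((v : ℝ) + w) * Real.log ((u : ℝ) + ((v : ℝ) + w) * t) - (w : ℝ) * Real.log (((u : ℝ) + v) + (w : ℝ) * t) - (v : ℝ) * Real.log t) - (v : ℝ) * Real.log (v : ℝ) := by
  have hv0 : (0 : ℝ) < v := by exact_mod_cast hv
  have hA : 0 < (((u : ℝ) + v) + (w : ℝ) * t) := by positivity
  have hB : 0 < ((u : ℝ) + ((v : ℝ) + w) * t) := by positivity
  have e1 : Real.log (a ^ v * c ^ u * (((u : ℝ) + v) + (w : ℝ) * t) ^ (u + v))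
      = (v : ℝ) * Real.log a + (u : ℝ) * Real.log c + ((u + v : ℕ) : ℝ) * Real.log (((u : ℝ) + v) + (w : ℝ) * t) :=
    log_pow_mul_pow_mul_pow ha hc hA _ _ _
  have e2 : Real.log (b ^ (u + v) * (v : ℝ) ^ v * ((u : ℝ) + ((v : ℝ) + w) * t) ^ u)
      = ((u + v : ℕ) : ℝ) * Real.log b + (v : ℝ) * Real.log (v : ℝ) + (u : ℝ) * Real.log ((u : ℝ) + ((v : ℝ) + w) * t) :=
    log_pow_mul_pow_mul_pow hb hv0 hB _ _ _
  have e3 : Real.log (b ^ w * e ^ v * ((u : ℝ) + ((v : ℝ) + w) * t) ^ (v + w))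
      = (w : ℝ) * Real.log b + (v : ℝ) * Real.log e + ((v + w : ℕ) : ℝ) * Real.log ((u : ℝ) + ((v : ℝ) + w) * t) :=
    log_pow_mul_pow_mul_pow hb he hB _ _ _
  have e4 : Real.log (c ^ (v + w) * (v : ℝ) ^ v * ((((u : ℝ) + v) + (w : ℝ) * t) ^ w * t ^ v))
      = ((v + w : ℕ) : ℝ) * Real.log c + (v : ℝ) * Real.log (v : ℝ)
        + ((w : ℝ) * Real.log (((u : ℝ) + v) + (w : ℝ) * t) + (v : ℝ) * Real.log t) := by
    rw [Real.log_mul (by positivity) (by positivity), Real.log_mul (by positivity) (by positivity),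
      Real.log_mul (by positivity) (by positivity), Real.log_pow, Real.log_pow, Real.log_pow, Real.log_pow]
  push_cast at e1 e2 e3 e4
  have hHp : b ^ (u + v) * (v : ℝ) ^ v * ((u : ℝ) + ((v : ℝ) + w) * t) ^ u
      ≤ a ^ v * c ^ u * (((u : ℝ) + v) + (w : ℝ) * t) ^ (u + v) := by
    refine (Real.log_le_log_iff (by positivity) (by positivity)).mp ?_
    rw [e1, e2]; linarith
  have hr := fourNomial_pocket_lower_of_three_le_countP' hu hv hw ha hb hc he h3 ht hlow hHp
  have hl := (Real.log_le_log_iff (by positivity) (by positivity)).mpr hr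
  rw [e3, e4] at hl
  linarith

/-- **Pocket row A′ (upper branch), log form**: `u(u+v) ≤ w(v+w)t`, `L1(t) ≤ σ1 ⇒ L2(t) ≤ σ2`. [folklore] -/
theorem fourNomial_pocket_upper_log {u v w : ℕ} (hu : 0 < u) (hv : 0 < v) (hw : 0 < w)
    {a b c e : ℝ} (ha : 0 < a) (hb : 0 < b) (hc : 0 < c) (he : 0 < e)
    (h3 : 3 ≤ (C a - C b * X ^ u + C c * X ^ (u + v) - C e * X ^ (u + v + w) : ℝ[X]).roots.countP (fun x => 0 < x))
    {t : ℝ} (hup : (u : ℝ) * ((u : ℝ) + v) ≤ (w : ℝ) * ((v : ℝ) + w) * t)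
    (hM : (((u : ℝ) + v) * Real.log (((u : ℝ) + v) + (w : ℝ) * t) - (u : ℝ) * Real.log ((u : ℝ) + ((v : ℝ) + w) * t)) - (v : ℝ) * Real.log (v : ℝ)
      ≤ (((u : ℝ) + v) * Real.log b - (v : ℝ) * Real.log a - (u : ℝ) * Real.log c)) :
    (((v : ℝ) + w) * Real.log ((u : ℝ) + ((v : ℝ) + w) * t) - (w : ℝ) * Real.log (((u : ℝ) + v) + (w : ℝ) * t) - (v : ℝ) * Real.log t) - (v : ℝ) * Real.log (v : ℝ)
      ≤ (((v : ℝ) + w) * Real.log c - (w : ℝ) * Real.log b - (v : ℝ) * Real.log e) := by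
  have ht : 0 < t := lt_of_lt_of_le (by positivity) ((div_le_iff₀ (by positivity)).mpr (by linarith [hup]) :
    (u : ℝ) * ((u : ℝ) + v) / ((w : ℝ) * ((v : ℝ) + w)) ≤ t)
  have hv0 : (0 : ℝ) < v := by exact_mod_cast hv
  have hA : 0 < (((u : ℝ) + v) + (w : ℝ) * t) := by positivity
  have hB : 0 < ((u : ℝ) + ((v : ℝ) + w) * t) := by positivity
  have e1 : Real.log (a ^ v * c ^ u * (((u : ℝ) + v) + (w : ℝ) * t) ^ (u + v))
      = (v : ℝ) * Real.log a + (u : ℝ) * Real.log c + ((u + v : ℕ) : ℝ) * Real.log (((u : ℝ) + v) + (w : ℝ) * t) :=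
    log_pow_mul_pow_mul_pow ha hc hA _ _ _
  have e2 : Real.log (b ^ (u + v) * (v : ℝ) ^ v * ((u : ℝ) + ((v : ℝ) + w) * t) ^ u)
      = ((u + v : ℕ) : ℝ) * Real.log b + (v : ℝ) * Real.log (v : ℝ) + (u : ℝ) * Real.log ((u : ℝ) + ((v : ℝ) + w) * t) :=
    log_pow_mul_pow_mul_pow hb hv0 hB _ _ _
  have e3 : Real.log (b ^ w * e ^ v * ((u : ℝ) + ((v : ℝ) + w) * t) ^ (v + w))
      = (w : ℝ) * Real.log b + (v : ℝ) * Real.log e + ((v + w : ℕ) : ℝ) * Real.log ((u : ℝ) + ((v : ℝ) + w) * t) :=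
    log_pow_mul_pow_mul_pow hb he hB _ _ _
  have e4 : Real.log (c ^ (v + w) * (v : ℝ) ^ v * ((((u : ℝ) + v) + (w : ℝ) * t) ^ w * t ^ v))
      = ((v + w : ℕ) : ℝ) * Real.log c + (v : ℝ) * Real.log (v : ℝ)
        + ((w : ℝ) * Real.log (((u : ℝ) + v) + (w : ℝ) * t) + (v : ℝ) * Real.log t) := by
    rw [Real.log_mul (by positivity) (by positivity), Real.log_mul (by positivity) (by positivity),
      Real.log_mul (by positivity) (by positivity), Real.log_pow, Real.log_pow, Real.log_pow, Real.log_pow]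
  push_cast at e1 e2 e3 e4
  have hMp : a ^ v * c ^ u * (((u : ℝ) + v) + (w : ℝ) * t) ^ (u + v)
      ≤ b ^ (u + v) * (v : ℝ) ^ v * ((u : ℝ) + ((v : ℝ) + w) * t) ^ u := by
    refine (Real.log_le_log_iff (by positivity) (by positivity)).mp ?_
    rw [e1, e2]; linarith
  have hr := fourNomial_pocket_upper_of_three_le_countP hu hv hw ha hb hc he h3 hup hMp
  have hl := (Real.log_le_log_iff (by positivity) (by positivity)).mpr hr
  rw [e3, e4] at hl
  linarith

/-- **Pocket row B′ (upper branch), log form**: `u(u+v) ≤ w(v+w)t`, `σ2 ≤ L2(t) ⇒ σ1 ≤ L1(t)`. [folklore] -/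
theorem fourNomial_pocket_upper_log' {u v w : ℕ} (hu : 0 < u) (hv : 0 < v) (hw : 0 < w)
    {a b c e : ℝ} (ha : 0 < a) (hb : 0 < b) (hc : 0 < c) (he : 0 < e)
    (h3 : 3 ≤ (C a - C b * X ^ u + C c * X ^ (u + v) - C e * X ^ (u + v + w) : ℝ[X]).roots.countP (fun x => 0 < x))
    {t : ℝ} (hup : (u : ℝ) * ((u : ℝ) + v) ≤ (w : ℝ) * ((v : ℝ) + w) * t)
    (hH : (((v : ℝ) + w) * Real.log c - (w : ℝ) * Real.log b - (v : ℝ) * Real.log e)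
      ≤ (((v : ℝ) + w) * Real.log ((u : ℝ) + ((v : ℝ) + w) * t) - (w : ℝ) * Real.log (((u : ℝ) + v) + (w : ℝ) * t) - (v : ℝ) * Real.log t) - (v : ℝ) * Real.log (v : ℝ)) :
    (((u : ℝ) + v) * Real.log b - (v : ℝ) * Real.log a - (u : ℝ) * Real.log c)
      ≤ (((u : ℝ) + v) * Real.log (((u : ℝ) + v) + (w : ℝ) * t) - (u : ℝ) * Real.log ((u : ℝ) + ((v : ℝ) + w) * t)) - (v : ℝ) * Real.log (v : ℝ) := by
  have ht : 0 < t := lt_of_lt_of_le (by positivity) ((div_le_iff₀ (by positivity)).mpr (by linarith [hup]) :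
    (u : ℝ) * ((u : ℝ) + v) / ((w : ℝ) * ((v : ℝ) + w)) ≤ t)
  have hv0 : (0 : ℝ) < v := by exact_mod_cast hv
  have hA : 0 < (((u : ℝ) + v) + (w : ℝ) * t) := by positivity
  have hB : 0 < ((u : ℝ) + ((v : ℝ) + w) * t) := by positivity
  have e1 : Real.log (a ^ v * c ^ u * (((u : ℝ) + v) + (w : ℝ) * t) ^ (u + v))
      = (v : ℝ) * Real.log a + (u : ℝ) * Real.log c + ((u + v : ℕ) : ℝ) * Real.log (((u : ℝ) + v) + (w : ℝ) * t) :=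
    log_pow_mul_pow_mul_pow ha hc hA _ _ _
  have e2 : Real.log (b ^ (u + v) * (v : ℝ) ^ v * ((u : ℝ) + ((v : ℝ) + w) * t) ^ u)
      = ((u + v : ℕ) : ℝ) * Real.log b + (v : ℝ) * Real.log (v : ℝ) + (u : ℝ) * Real.log ((u : ℝ) + ((v : ℝ) + w) * t) :=
    log_pow_mul_pow_mul_pow hb hv0 hB _ _ _
  have e3 : Real.log (b ^ w * e ^ v * ((u : ℝ) + ((v : ℝ) + w) * t) ^ (v + w))
      = (w : ℝ) * Real.log b + (v : ℝ) * Real.log e + ((v + w : ℕ) : ℝ) * Real.log ((u : ℝ) + ((v : ℝ) + w) * t) :=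
    log_pow_mul_pow_mul_pow hb he hB _ _ _
  have e4 : Real.log (c ^ (v + w) * (v : ℝ) ^ v * ((((u : ℝ) + v) + (w : ℝ) * t) ^ w * t ^ v))
      = ((v + w : ℕ) : ℝ) * Real.log c + (v : ℝ) * Real.log (v : ℝ)
        + ((w : ℝ) * Real.log (((u : ℝ) + v) + (w : ℝ) * t) + (v : ℝ) * Real.log t) := by
    rw [Real.log_mul (by positivity) (by positivity), Real.log_mul (by positivity) (by positivity),
      Real.log_mul (by positivity) (by positivity), Real.log_pow, Real.log_pow, Real.log_pow, Real.log_pow]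
  push_cast at e1 e2 e3 e4
  have hHp : c ^ (v + w) * (v : ℝ) ^ v * ((((u : ℝ) + v) + (w : ℝ) * t) ^ w * t ^ v)
      ≤ b ^ w * e ^ v * ((u : ℝ) + ((v : ℝ) + w) * t) ^ (v + w) := by
    refine (Real.log_le_log_iff (by positivity) (by positivity)).mp ?_
    rw [e3, e4]; linarith
  have hr := fourNomial_pocket_upper_of_three_le_countP' hu hv hw ha hb hc he h3 hup hHp
  have hl := (Real.log_le_log_iff (by positivity) (by positivity)).mpr hr
  rw [e1, e2] at hl
  linarith

/-! ## NUMERAL-FRIENDLY form: the branch constants enter through closed rational comparisons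

What a kernel kill file has at a node: the branch fact `log M ≤ σ2` (resp. `σ1 ≤ log H`, …) with a SMOOTH rational `M`, and closed
rational inequalities checkable by `norm_num` relating `M`, the emitted constant `F` and the branch parameter `t = tn/td`:
`H2(t) ≤ M`, `F ≤ H1(t)` etc., written as products (`pocket_…_of_prod` in `…CensusWindowFourPocketCalculus`). -/

/-- **Pocket row A, numeral form** (lower `t`): `H2(t) ≤ M`, `F ≤ H1(t)` (closed rational facts), `log M ≤ σ2` ⇒ `log F ≤ σ1`. [folklore] -/
theorem fourNomial_pocket_lower_log_of_le {u v w : ℕ} (hu : 0 < u) (hv : 0 < v) (hw : 0 < w)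
    {a b c e : ℝ} (ha : 0 < a) (hb : 0 < b) (hc : 0 < c) (he : 0 < e)
    (h3 : 3 ≤ (C a - C b * X ^ u + C c * X ^ (u + v) - C e * X ^ (u + v + w) : ℝ[X]).roots.countP (fun x => 0 < x))
    {t M F : ℝ} (ht : 0 < t) (hlow : (w : ℝ) * ((v : ℝ) + w) * t ≤ (u : ℝ) * ((u : ℝ) + v)) (hM : 0 < M) (hF : 0 < F)
    (hMt : ((u : ℝ) + ((v : ℝ) + w) * t) ^ (v + w) ≤ M * ((v : ℝ) ^ v * ((((u : ℝ) + v) + (w : ℝ) * t) ^ w * t ^ v)))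
    (hFt : F * ((v : ℝ) ^ v * ((u : ℝ) + ((v : ℝ) + w) * t) ^ u) ≤ (((u : ℝ) + v) + (w : ℝ) * t) ^ (u + v))
    (hσ : Real.log M ≤ (((v : ℝ) + w) * Real.log c - (w : ℝ) * Real.log b - (v : ℝ) * Real.log e)) :
    Real.log F ≤ (((u : ℝ) + v) * Real.log b - (v : ℝ) * Real.log a - (u : ℝ) * Real.log c) :=
  (pocket_le_logH1_of_prod (w := w) hu hv ht hF hFt).trans
    (fourNomial_pocket_lower_log hu hv hw ha hb hc he h3 ht hlow ((pocket_logH2_le_of_prod hu hv ht hM hMt).trans hσ))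

/-- **Pocket row B, numeral form** (lower `t`): `H ≤ H1(t)`, `H2(t) ≤ G`, `σ1 ≤ log H` ⇒ `σ2 ≤ log G`. [folklore] -/
theorem fourNomial_pocket_lower_log_of_le' {u v w : ℕ} (hu : 0 < u) (hv : 0 < v) (hw : 0 < w)
    {a b c e : ℝ} (ha : 0 < a) (hb : 0 < b) (hc : 0 < c) (he : 0 < e)
    (h3 : 3 ≤ (C a - C b * X ^ u + C c * X ^ (u + v) - C e * X ^ (u + v + w) : ℝ[X]).roots.countP (fun x => 0 < x))
    {t H G : ℝ} (ht : 0 < t) (hlow : (w : ℝ) * ((v : ℝ) + w) * t ≤ (u : ℝ) * ((u : ℝ) + v)) (hH : 0 < H) (hG : 0 < G)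
    (hHt : H * ((v : ℝ) ^ v * ((u : ℝ) + ((v : ℝ) + w) * t) ^ u) ≤ (((u : ℝ) + v) + (w : ℝ) * t) ^ (u + v))
    (hGt : ((u : ℝ) + ((v : ℝ) + w) * t) ^ (v + w) ≤ G * ((v : ℝ) ^ v * ((((u : ℝ) + v) + (w : ℝ) * t) ^ w * t ^ v)))
    (hσ : (((u : ℝ) + v) * Real.log b - (v : ℝ) * Real.log a - (u : ℝ) * Real.log c) ≤ Real.log H) :
    (((v : ℝ) + w) * Real.log c - (w : ℝ) * Real.log b - (v : ℝ) * Real.log e) ≤ Real.log G :=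
  (fourNomial_pocket_lower_log' hu hv hw ha hb hc he h3 ht hlow (hσ.trans (pocket_le_logH1_of_prod (w := w) hu hv ht hH hHt))).trans
    (pocket_logH2_le_of_prod hu hv ht hG hGt)

/-- **Pocket row A′, numeral form** (upper `t`): `H1(t) ≤ M`, `F ≤ H2(t)`, `log M ≤ σ1` ⇒ `log F ≤ σ2`. [folklore] -/
theorem fourNomial_pocket_upper_log_of_le {u v w : ℕ} (hu : 0 < u) (hv : 0 < v) (hw : 0 < w)
    {a b c e : ℝ} (ha : 0 < a) (hb : 0 < b) (hc : 0 < c) (he : 0 < e)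
    (h3 : 3 ≤ (C a - C b * X ^ u + C c * X ^ (u + v) - C e * X ^ (u + v + w) : ℝ[X]).roots.countP (fun x => 0 < x))
    {t M F : ℝ} (hup : (u : ℝ) * ((u : ℝ) + v) ≤ (w : ℝ) * ((v : ℝ) + w) * t) (hM : 0 < M) (hF : 0 < F)
    (hMt : (((u : ℝ) + v) + (w : ℝ) * t) ^ (u + v) ≤ M * ((v : ℝ) ^ v * ((u : ℝ) + ((v : ℝ) + w) * t) ^ u))
    (hFt : F * ((v : ℝ) ^ v * ((((u : ℝ) + v) + (w : ℝ) * t) ^ w * t ^ v)) ≤ ((u : ℝ) + ((v : ℝ) + w) * t) ^ (v + w))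
    (hσ : Real.log M ≤ (((u : ℝ) + v) * Real.log b - (v : ℝ) * Real.log a - (u : ℝ) * Real.log c)) :
    Real.log F ≤ (((v : ℝ) + w) * Real.log c - (w : ℝ) * Real.log b - (v : ℝ) * Real.log e) := by
  have ht : 0 < t := lt_of_lt_of_le (by positivity) ((div_le_iff₀ (by positivity)).mpr (by linarith [hup]) :
    (u : ℝ) * ((u : ℝ) + v) / ((w : ℝ) * ((v : ℝ) + w)) ≤ t)
  exact (pocket_le_logH2_of_prod hu hv ht hF hFt).trans
    (fourNomial_pocket_upper_log hu hv hw ha hb hc he h3 hup ((pocket_logH1_le_of_prod (w := w) hu hv ht hM hMt).trans hσ))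

/-- **Pocket row B′, numeral form** (upper `t`): `H ≤ H2(t)`, `H1(t) ≤ G`, `σ2 ≤ log H` ⇒ `σ1 ≤ log G`. [folklore] -/
theorem fourNomial_pocket_upper_log_of_le' {u v w : ℕ} (hu : 0 < u) (hv : 0 < v) (hw : 0 < w)
    {a b c e : ℝ} (ha : 0 < a) (hb : 0 < b) (hc : 0 < c) (he : 0 < e)
    (h3 : 3 ≤ (C a - C b * X ^ u + C c * X ^ (u + v) - C e * X ^ (u + v + w) : ℝ[X]).roots.countP (fun x => 0 < x))
    {t H G : ℝ} (hup : (u : ℝ) * ((u : ℝ) + v) ≤ (w : ℝ) * ((v : ℝ) + w) * t) (hH : 0 < H) (hG : 0 < G)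
    (hHt : H * ((v : ℝ) ^ v * ((((u : ℝ) + v) + (w : ℝ) * t) ^ w * t ^ v)) ≤ ((u : ℝ) + ((v : ℝ) + w) * t) ^ (v + w))
    (hGt : (((u : ℝ) + v) + (w : ℝ) * t) ^ (u + v) ≤ G * ((v : ℝ) ^ v * ((u : ℝ) + ((v : ℝ) + w) * t) ^ u))
    (hσ : (((v : ℝ) + w) * Real.log c - (w : ℝ) * Real.log b - (v : ℝ) * Real.log e) ≤ Real.log H) :
    (((u : ℝ) + v) * Real.log b - (v : ℝ) * Real.log a - (u : ℝ) * Real.log c) ≤ Real.log G := by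
  have ht : 0 < t := lt_of_lt_of_le (by positivity) ((div_le_iff₀ (by positivity)).mpr (by linarith [hup]) :
    (u : ℝ) * ((u : ℝ) + v) / ((w : ℝ) * ((v : ℝ) + w)) ≤ t)
  exact (fourNomial_pocket_upper_log' hu hv hw ha hb hc he h3 hup (hσ.trans (pocket_le_logH2_of_prod hu hv ht hH hHt))).trans
    (pocket_logH1_le_of_prod (w := w) hu hv ht hG hGt)

end Summit.ValiantsHypothesis.ValiantsHypothesis.Theorems.LacunarySymmetroidMatrixDescartes.Census
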